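import Literature.Analysis.FunctionSpaces.TorusSpectralWeakDerivative
import Literature.Analysis.FunctionSpaces.TorusHolderSobolevEmbedding
import Mathlib.Analysis.SpecialFunctions.Trigonometric.Bounds
import HarnessLib

/-!
# The `L²` translation estimate `‖v(· + z) - v‖₂ ≤ |z| ‖∇v‖₂` on the flat torus (spectral form)

Analysis/FunctionSpaces support file (everything proved). For a real vector field
`v ∈ L²(T^d; ℝ^d)` with spectral gradient norm `Torus.eGradNormSq v = 4π² ∑ₖ |k|² ‖v̂(k)‖²`
and a translation `z = proj z̃ ∈ T^d`,

  `∫ ‖v(x + z) - v(x)‖² dx ≤ ‖z̃‖² · eGradNormSq v`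

(`Torus.lintegral_enorm_sub_translate_sq_le`): Parseval, `𝓕(f(· + h) - f)(k) = (e_k(h) - 1) f̂(k)`
(the tree's `Torus.mFourierCoeff_comp_add_right_sub`, `TorusHolderSobolevEmbedding`) and
`|e^{2πi k·z̃} - 1| ≤ 2π |k·z̃| ≤ 2π |k| ‖z̃‖`.
This is the `W^{1,2}` difference-quotient bound behind the DiPerna–Lions commutator estimate for
Sobolev (rather than Lipschitz) velocity fields (DiPerna–Lions 1989, Lemma II.1), as needed for
the `L² ∩ Ḣ¹` drifts of Seis 2022, Thm. 2.

## References

* R. J. DiPerna, P.-L. Lions, Invent. Math. 98 (1989), §II.1, Lemma II.1. [`DiPernaLions1989`]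
* L. Grafakos, *Classical Fourier Analysis* (3rd ed. 2014), Prop. 3.2.7 (3). [`Grafakos2014`]
-/

noncomputable section

open MeasureTheory Set Filter Topology UnitAddTorus
open scoped ENNReal InnerProductSpace

namespace Literature.Analysis.FunctionSpaces

namespace Torus

variable {d : Type*} [Fintype d]

/-! ## The character increment `|e_k(proj z̃) - 1| ≤ 2π |k| ‖z̃‖` -/

/-- Explicit form of a character at a lifted point: `e_k(proj z̃) = exp(2πi ∑ᵢ kᵢ z̃ᵢ)`. [folklore] -/
theorem mFourier_proj_eq_exp_sum (k : d → ℤ) (z : EuclideanSpace ℝ d) :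
    mFourier k (proj z) = Complex.exp (2 * Real.pi * Complex.I * (∑ i, (k i : ℝ) * z i : ℝ)) := by
  simp only [mFourier, ContinuousMap.coe_mk, proj_apply, fourier_coe_apply]
  rw [← Complex.exp_sum]
  congr 1
  push_cast
  rw [Finset.mul_sum]
  refine Finset.sum_congr rfl fun i _ => ?_
  ring

/-- `|e_k(proj z̃) - 1| ≤ 2π |k| ‖z̃‖` (`|e^{iα} - 1| ≤ |α|` and Cauchy–Schwarz). [folklore] -/
theorem norm_mFourier_proj_sub_one_le (k : d → ℤ) (z : EuclideanSpace ℝ d) :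
    ‖mFourier k (proj z) - 1‖ ≤ 2 * Real.pi * Real.sqrt (freqNormSq k) * ‖z‖ := by
  rw [mFourier_proj_eq_exp_sum]
  have h1 : ‖Complex.exp (2 * Real.pi * Complex.I * (∑ i, (k i : ℝ) * z i : ℝ)) - 1‖ ≤
      ‖2 * Real.pi * ∑ i, (k i : ℝ) * z i‖ := by
    have := Real.norm_exp_I_mul_ofReal_sub_one_le (x := 2 * Real.pi * ∑ i, (k i : ℝ) * z i)
    convert this using 3
    push_cast
    ring
  refine h1.trans ?_
  rw [Real.norm_eq_abs, abs_mul, abs_of_pos Real.two_pi_pos, mul_assoc (2 * Real.pi)]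
  refine mul_le_mul_of_nonneg_left ?_ Real.two_pi_pos.le
  -- Cauchy–Schwarz in `ℝ^d`
  set kv : EuclideanSpace ℝ d := WithLp.toLp 2 fun i => (k i : ℝ) with hkv
  have hcs := abs_real_inner_le_norm kv z
  have hinner : ⟪kv, z⟫_ℝ = ∑ i, (k i : ℝ) * z i := by
    rw [hkv, PiLp.inner_apply]
    refine Finset.sum_congr rfl fun i _ => ?_
    simp [mul_comm]
  have hnorm : ‖kv‖ = Real.sqrt (freqNormSq k) := by
    rw [EuclideanSpace.norm_eq, freqNormSq]
    congr 1
    refine Finset.sum_congr rfl fun i _ => ?_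
    simp [hkv]
  rw [hinner, hnorm] at hcs
  exact hcs

/-- Squared `ℝ≥0∞` form: `‖e_k(proj z̃) - 1‖ₑ² ≤ ofReal(4π²) ofReal(|k|²) ofReal(‖z̃‖²)`. [folklore] -/
theorem enorm_mFourier_proj_sub_one_sq_le (k : d → ℤ) (z : EuclideanSpace ℝ d) :
    ‖mFourier k (proj z) - 1‖ₑ ^ 2 ≤
      ENNReal.ofReal (4 * Real.pi ^ 2) * ENNReal.ofReal (freqNormSq k) * ENNReal.ofReal (‖z‖ ^ 2) := by
  have h := norm_mFourier_proj_sub_one_le k z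
  have hpi : 0 ≤ 4 * Real.pi ^ 2 := by positivity
  rw [← ofReal_norm, ← ENNReal.ofReal_pow (norm_nonneg _), ← ENNReal.ofReal_mul hpi,
    ← ENNReal.ofReal_mul (mul_nonneg hpi (freqNormSq_nonneg k))]
  refine ENNReal.ofReal_le_ofReal ?_
  calc ‖mFourier k (proj z) - 1‖ ^ 2 ≤ (2 * Real.pi * Real.sqrt (freqNormSq k) * ‖z‖) ^ 2 :=
        pow_le_pow_left₀ (norm_nonneg _) h 2
    _ = 4 * Real.pi ^ 2 * freqNormSq k * ‖z‖ ^ 2 := by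
        rw [mul_pow, mul_pow, mul_pow, Real.sq_sqrt (freqNormSq_nonneg k)]
        ring

/-! ## The translation estimate -/

/-- Parseval for one translated component: `∫ |g(x + h) - g(x)|² = ∑ₖ |e_k(h) - 1|² |ĝ(k)|²`
for `g ∈ L²(T^d; ℂ)`. [folklore] -/
theorem lintegral_enorm_sub_translate_sq_eq_tsum {g : UnitAddTorus d → ℂ} (hg : MemLp g 2 volume)
    (h : UnitAddTorus d) :
    ∫⁻ x, ‖g (x + h) - g x‖ₑ ^ 2 =
      ∑' k : d → ℤ, ‖mFourier k h - 1‖ₑ ^ 2 * ‖mFourierCoeff g k‖ₑ ^ 2 := by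
  have hgt : MemLp (fun x => g (x + h)) 2 volume :=
    hg.comp_measurePreserving (measurePreserving_add_right volume h)
  have hD : MemLp (fun x => g (x + h) - g x) 2 volume := hgt.sub hg
  rw [← tsum_enorm_sq_mFourierCoeff hD]
  refine tsum_congr fun k => ?_
  rw [mFourierCoeff_comp_add_right_sub (hg.integrable one_le_two), enorm_smul, mul_pow]

/-- **The `L²` translation estimate in spectral form** (DiPerna–Lions 1989, Lemma II.1, the
difference-quotient bound for `W^{1,2}` fields; Grafakos 2014, Prop. 3.2.7 (3)): for
`v ∈ L²(T^d; ℝ^d)` and `z̃ ∈ ℝ^d`,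
`∫ ‖v(x + proj z̃) - v(x)‖² dx ≤ ‖z̃‖² · eGradNormSq v`. [cite: DiPernaLions1989, Lemma II.1] -/
theorem lintegral_enorm_sub_translate_sq_le {v : UnitAddTorus d → EuclideanSpace ℝ d}
    (hv : MemLp v 2 volume) (z : EuclideanSpace ℝ d) :
    ∫⁻ x, ‖v (x + proj z) - v x‖ₑ ^ 2 ≤ ENNReal.ofReal (‖z‖ ^ 2) * eGradNormSq v := by
  classical
  set w : UnitAddTorus d → EuclideanSpace ℂ d := EuclideanSpace.complexify ∘ v with hw
  have hwi : Integrable w volume :=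
    EuclideanSpace.complexify.toContinuousLinearMap.integrable_comp (hv.integrable one_le_two)
  -- pass to the complexification, componentwise (components are `L²` by
  -- `Torus.memLp_ofReal_apply`, `TorusVectorParseval`; `complexify (v x) i = (v x i : ℂ)` is `rfl`)
  have hnorm : ∀ x, ‖v (x + proj z) - v x‖ₑ ^ 2 = ∑ i, ‖w (x + proj z) i - w x i‖ₑ ^ 2 := by
    intro x
    have : ‖v (x + proj z) - v x‖ₑ = ‖w (x + proj z) - w x‖ₑ := by
      rw [hw, Function.comp_apply, Function.comp_apply, ← map_sub, ← ofReal_norm, ← ofReal_norm,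
        EuclideanSpace.norm_complexify]
    rw [this, enorm_sq_eq_sum_euclidean]
    rfl
  simp_rw [hnorm]
  have hmeas : ∀ i, AEMeasurable (fun x => ‖w (x + proj z) i - w x i‖ₑ ^ 2) volume := fun i =>
    (((memLp_ofReal_apply hv i).aestronglyMeasurable.comp_measurePreserving
      (measurePreserving_add_right volume (proj z))).sub
      (memLp_ofReal_apply hv i).aestronglyMeasurable).enorm.pow_const 2
  rw [lintegral_finsetSum' _ fun i _ => hmeas i]
  -- Parseval for each component
  have hP : ∀ i, ∫⁻ x, ‖w (x + proj z) i - w x i‖ₑ ^ 2 =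
      ∑' k : d → ℤ, ‖mFourier k (proj z) - 1‖ₑ ^ 2 * ‖mFourierCoeff (fun x => w x i) k‖ₑ ^ 2 :=
    fun i => lintegral_enorm_sub_translate_sq_eq_tsum (memLp_ofReal_apply hv i) (proj z)
  simp_rw [hP]
  rw [← Summable.tsum_finsetSum fun i _ => ENNReal.summable]
  -- `∑ᵢ |𝓕wᵢ(k)|² = ‖𝓕w(k)‖²`
  have hcomp : ∀ k : d → ℤ, ∑ i, ‖mFourier k (proj z) - 1‖ₑ ^ 2 * ‖mFourierCoeff (fun x => w x i) k‖ₑ ^ 2 =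
      ‖mFourier k (proj z) - 1‖ₑ ^ 2 * ‖mFourierCoeff w k‖ₑ ^ 2 := by
    intro k
    rw [← Finset.mul_sum, enorm_sq_eq_sum_euclidean]
    congr 1
    refine Finset.sum_congr rfl fun i _ => ?_
    rw [mFourierCoeff_apply_euclidean hwi]
  simp_rw [hcomp]
  -- the frequency bound and `eGradNormSq_eq_tsum`
  calc ∑' k : d → ℤ, ‖mFourier k (proj z) - 1‖ₑ ^ 2 * ‖mFourierCoeff w k‖ₑ ^ 2
      ≤ ∑' k : d → ℤ, (ENNReal.ofReal (4 * Real.pi ^ 2) * ENNReal.ofReal (freqNormSq k) *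
          ENNReal.ofReal (‖z‖ ^ 2)) * ‖mFourierCoeff w k‖ₑ ^ 2 :=
        ENNReal.tsum_le_tsum fun k => mul_le_mul' (enorm_mFourier_proj_sub_one_sq_le k z) le_rfl
    _ = ENNReal.ofReal (‖z‖ ^ 2) * eGradNormSq v := by
        rw [eGradNormSq_eq_tsum, ← hw, ← ENNReal.tsum_mul_left, ← ENNReal.tsum_mul_left]
        refine tsum_congr fun k => ?_
        ring

/-- `L²`-norm form: `‖v(· + proj z̃) - v‖_{L²} ≤ ‖z̃‖ (eGradNormSq v)^{1/2}`. [folklore] -/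
theorem eLpNorm_sub_translate_le {v : UnitAddTorus d → EuclideanSpace ℝ d}
    (hv : MemLp v 2 volume) (z : EuclideanSpace ℝ d) :
    eLpNorm (fun x => v (x + proj z) - v x) 2 volume ≤
      ENNReal.ofReal ‖z‖ * eGradNormSq v ^ (1 / 2 : ℝ) := by
  have h := lintegral_enorm_sub_translate_sq_le hv z
  have hmeas : AEStronglyMeasurable (fun x => v (x + proj z) - v x) volume :=
    (hv.aestronglyMeasurable.comp_measurePreserving (measurePreserving_add_right volume (proj z))).sub
      hv.aestronglyMeasurable
  rw [eLpNorm_eq_lintegral_rpow_enorm_toReal two_ne_zero ENNReal.ofNat_ne_top]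
  simp only [ENNReal.toReal_ofNat, one_div]
  have h2 : ∫⁻ x, ‖v (x + proj z) - v x‖ₑ ^ (2 : ℝ) = ∫⁻ x, ‖v (x + proj z) - v x‖ₑ ^ 2 :=
    lintegral_congr fun x => by rw [← ENNReal.rpow_natCast]; norm_num
  rw [h2]
  calc (∫⁻ x, ‖v (x + proj z) - v x‖ₑ ^ 2) ^ (2 : ℝ)⁻¹
      ≤ (ENNReal.ofReal (‖z‖ ^ 2) * eGradNormSq v) ^ (2 : ℝ)⁻¹ := ENNReal.rpow_le_rpow h (by norm_num)
    _ = ENNReal.ofReal ‖z‖ * eGradNormSq v ^ (2 : ℝ)⁻¹ := by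
        rw [ENNReal.mul_rpow_of_nonneg _ _ (by norm_num), ENNReal.ofReal_pow (norm_nonneg _),
          ← ENNReal.rpow_natCast, ← ENNReal.rpow_mul]
        norm_num

end Torus

end Literature.Analysis.FunctionSpaces
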